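import Summits.BirchSwinnertonDyer.BirchSwinnertonDyer.Theorems.BiquadraticEisensteinDescentHeegnerTwistCouplingInSupplySymbolicMonskyDesignRows
import HarnessLib

set_option linter.dupNamespace false -- `Summit.BirchSwinnertonDyer.BirchSwinnertonDyer.Theorems.…` (summit = sub)
set_option autoImplicit false

/-!
# Crux `HeegnerTwistCouplingInSupply` (stmt-BirchSwinnertonDyer-21381) — Z-DESIGNS ON THE EVEN BASES `E_{2·P₀⋯P_k}`, part 1:
# row expansions of Monsky's EVEN matrix of `dataK base aux pat` and the four pattern-independent EVEN identities

Route `BiquadraticEisensteinDescent` (cell `pub/bsd-wall`, width seat `bsd-wall-cm-bed-w3` g23; `--supports` 21381, helper). The even twin of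
`…SymbolicMonskyTwoPrimeRows` (row expansions) and `…SymbolicMonskyDesignRows` (`design_identities`) — memo THEOREM-A-w3g22 §6b («EVEN bases:
Lean = successor unit»). Same design menu `c₁ :: rest` (one cell `q₁ ≡ 3 (4)` with bits `m + Σσ_i` and `(2/·)`-class `Σ d'_i`, `τ` free cells
`≡ 1 (4)`), same Heegner check; Monsky's EVEN matrix `(Aᵀ + D₂, D₋₁; D₂, A + D₂)` [HeathBrown1994, appendix (Monsky), typescript p. 41] has
the TRANSPOSED `A` in half one, i.e. the rows of half one carry the reciprocity correction `Σ_{j ≠ i} [3,3]_{ij} z_j` of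
`SymbData.monskyEvenS_mulVec_inl`.

* `sum_univ_base_aux`, `natAdd_ne_castAdd` — index bookkeeping; `mulVecEven_{inl,inr}_{castAdd,natAdd}_expand` — the four row families of
  `M_even(dataK base aux pat) z` for ANY `z` and any cell list;
* `sum_corr_base_base/aux`, `sum_corr_head_base/aux`, `sum_corr_tail` — the reciprocity corrections for a design (only `q₁` and the base primes
  `≡ 3 (4)` contribute): base row `m_b(⟨m,u⟩ + u_b + U₀)`, head row `⟨m,u⟩`, tail rows `0`;
* ★ `even_design_identities`: for the reference even matrix and ANY `z` killed by the base rows and the two auxiliary row-sums, with `u_b, v_b` the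
  base coordinates, `U₀,V₀ / U_i,V_i` those of `q₁ / q_{i+1}`, `a_i = U_i + U₀`, `e_i = V_i + V₀` (the `v`-DIFFERENCES — in the odd case it was
  `w = u+v`), `c_i = |σ_i|`: (E1) `Lu + m⟨m,u⟩ + D_d u + D_m v = Σ a_i σ_i` [= `(Lᵀ + D_d)u + D_m(u+v)`], (E2) `D_d u + Lv + D_m v + D_d v + V₀ m = Σ e_i σ_i`,
  (E3) `Σ_i (d'_i a_i + (c_i + d'_i) e_i) = 0`, (E4) `V₀ = ⟨m,u⟩ + Σ_i (c_i + d'_i) a_i` — memo §6b's (E1), (E2), (Σ) at general `k` AND `τ`,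
  now kernel-checked (numerics there: 1500/1500).

HONEST FRAMING: bookkeeping over `𝔽₂`; RUNG-LEVEL corner layer (EVEN congruent `j = 1728` families); the crux (C⁺), its registered stubs and BSD are
untouched; nothing is closed. THEOREMS ONLY. Reference: [HeathBrown1994] D. R. Heath-Brown, Invent. Math. 118 (1994) 331–370, appendix (Monsky),
typescript p. 41 L20–L36.
-/

namespace Summit.BirchSwinnertonDyer.BirchSwinnertonDyer.Theorems.SymbolicMonsky

section EvenRowsGeneral

open Matrix

variable {k : ℕ} (base : SymbData (k + 1)) (aux : List AuxCell) (pat : ℕ → ℕ → Bool)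

/-- Splitting a sum over all indices of `dataK base aux pat` into base and auxiliary parts (a named instance of `Fin.sum_univ_add`,
so that rewriting does not split `Fin (k + 1)` itself). -/
theorem sum_univ_base_aux (F : Fin (k + 1 + aux.length) → ZMod 2) :
    (∑ i, F i) = (∑ b : Fin (k + 1), F (Fin.castAdd aux.length b)) + ∑ j : Fin aux.length, F (Fin.natAdd (k + 1) j) :=
  Fin.sum_univ_add F

/-- An auxiliary index is never a base index. -/
theorem natAdd_ne_castAdd (j : Fin aux.length) (b : Fin (k + 1)) :
    (Fin.natAdd (k + 1) j : Fin (k + 1 + aux.length)) ≠ Fin.castAdd aux.length b := by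
  intro h
  have := congrArg Fin.val h
  simp [Fin.val_natAdd, Fin.val_castAdd] at this
  omega

/-- Base row, half one, EVEN matrix, general vector: Laplacian part (base + auxiliary), the transposition correction
`Σ_{j ≠ i} [3,3]_{ij} z_j` (base + auxiliary), `D₂` on half one and `D₋₁` on half two. -/
theorem mulVecEven_inl_castAdd_expand (z : Fin (k + 1 + aux.length) ⊕ Fin (k + 1 + aux.length) → ZMod 2) (b : Fin (k + 1)) :
    ((dataK base aux pat).monskyEvenS *ᵥ z) (Sum.inl (Fin.castAdd aux.length b)) =
      ((∑ b' : Fin (k + 1), bz (base.neg b b') * (z (Sum.inl (Fin.castAdd aux.length b')) + z (Sum.inl (Fin.castAdd aux.length b)))) +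
        (∑ j : Fin aux.length, bz ((aux.getD j.val (0, 0)).2.testBit b.val) *
          (z (Sum.inl (Fin.natAdd (k + 1) j)) + z (Sum.inl (Fin.castAdd aux.length b))))) +
      ((∑ b' : Fin (k + 1), (if b' = b then 0 else
          bz (negNegOne (base.cls b) && negNegOne (base.cls b')) * z (Sum.inl (Fin.castAdd aux.length b')))) +
        (∑ j : Fin aux.length, bz (negNegOne (base.cls b) && negNegOne (aux.getD j.val (0, 0)).1) * z (Sum.inl (Fin.natAdd (k + 1) j)))) +
      bz (negTwo (base.cls b)) * z (Sum.inl (Fin.castAdd aux.length b)) +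
      bz (negNegOne (base.cls b)) * z (Sum.inr (Fin.castAdd aux.length b)) := by
  rw [SymbData.monskyEvenS_mulVec_inl, Finset.sum_add_distrib, sum_univ_base_aux aux, sum_univ_base_aux aux]
  simp only [dataK_neg_castAdd_castAdd, dataK_neg_castAdd_natAdd, RealisesK.dataK_cls_castAdd, RealisesK.dataK_cls_natAdd,
    Fin.castAdd_inj, natAdd_ne_castAdd, if_false]

/-- Base row, half two, EVEN matrix, general vector. -/
theorem mulVecEven_inr_castAdd_expand (z : Fin (k + 1 + aux.length) ⊕ Fin (k + 1 + aux.length) → ZMod 2) (b : Fin (k + 1)) :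
    ((dataK base aux pat).monskyEvenS *ᵥ z) (Sum.inr (Fin.castAdd aux.length b)) =
      bz (negTwo (base.cls b)) * z (Sum.inl (Fin.castAdd aux.length b)) +
      ((∑ b' : Fin (k + 1), bz (base.neg b b') * (z (Sum.inr (Fin.castAdd aux.length b')) + z (Sum.inr (Fin.castAdd aux.length b)))) +
       (∑ j : Fin aux.length, bz ((aux.getD j.val (0, 0)).2.testBit b.val) *
          (z (Sum.inr (Fin.natAdd (k + 1) j)) + z (Sum.inr (Fin.castAdd aux.length b))))) +
      bz (negTwo (base.cls b)) * z (Sum.inr (Fin.castAdd aux.length b)) := by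
  rw [SymbData.monskyEvenS_mulVec_inr, sum_univ_base_aux aux]
  simp only [dataK_neg_castAdd_castAdd, dataK_neg_castAdd_natAdd, RealisesK.dataK_cls_castAdd]

/-- Auxiliary row, half one, EVEN matrix, general vector. -/
theorem mulVecEven_inl_natAdd_expand (z : Fin (k + 1 + aux.length) ⊕ Fin (k + 1 + aux.length) → ZMod 2) (j : Fin aux.length) :
    ((dataK base aux pat).monskyEvenS *ᵥ z) (Sum.inl (Fin.natAdd (k + 1) j)) =
      ((∑ b : Fin (k + 1), bz ((dataK base aux pat).neg (Fin.natAdd (k + 1) j) (Fin.castAdd aux.length b)) *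
          (z (Sum.inl (Fin.castAdd aux.length b)) + z (Sum.inl (Fin.natAdd (k + 1) j)))) +
        (∑ j' : Fin aux.length, bz ((dataK base aux pat).neg (Fin.natAdd (k + 1) j) (Fin.natAdd (k + 1) j')) *
          (z (Sum.inl (Fin.natAdd (k + 1) j')) + z (Sum.inl (Fin.natAdd (k + 1) j))))) +
      ((∑ b : Fin (k + 1), bz (negNegOne (aux.getD j.val (0, 0)).1 && negNegOne (base.cls b)) * z (Sum.inl (Fin.castAdd aux.length b))) +
        (∑ j' : Fin aux.length, (if j' = j then 0 else
          bz (negNegOne (aux.getD j.val (0, 0)).1 && negNegOne (aux.getD j'.val (0, 0)).1) * z (Sum.inl (Fin.natAdd (k + 1) j'))))) +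
      bz (negTwo (aux.getD j.val (0, 0)).1) * z (Sum.inl (Fin.natAdd (k + 1) j)) +
      bz (negNegOne (aux.getD j.val (0, 0)).1) * z (Sum.inr (Fin.natAdd (k + 1) j)) := by
  rw [SymbData.monskyEvenS_mulVec_inl, Finset.sum_add_distrib, sum_univ_base_aux aux, sum_univ_base_aux aux]
  have hne : ∀ b : Fin (k + 1), (Fin.castAdd aux.length b : Fin (k + 1 + aux.length)) ≠ Fin.natAdd (k + 1) j :=
    fun b h => natAdd_ne_castAdd aux j b h.symm
  simp only [RealisesK.dataK_cls_castAdd, RealisesK.dataK_cls_natAdd, hne, if_false, Fin.natAdd_inj]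

/-- Auxiliary row, half two, EVEN matrix, general vector. -/
theorem mulVecEven_inr_natAdd_expand (z : Fin (k + 1 + aux.length) ⊕ Fin (k + 1 + aux.length) → ZMod 2) (j : Fin aux.length) :
    ((dataK base aux pat).monskyEvenS *ᵥ z) (Sum.inr (Fin.natAdd (k + 1) j)) =
      bz (negTwo (aux.getD j.val (0, 0)).1) * z (Sum.inl (Fin.natAdd (k + 1) j)) +
      ((∑ b : Fin (k + 1), bz ((dataK base aux pat).neg (Fin.natAdd (k + 1) j) (Fin.castAdd aux.length b)) *
          (z (Sum.inr (Fin.castAdd aux.length b)) + z (Sum.inr (Fin.natAdd (k + 1) j)))) +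
       (∑ j' : Fin aux.length, bz ((dataK base aux pat).neg (Fin.natAdd (k + 1) j) (Fin.natAdd (k + 1) j')) *
          (z (Sum.inr (Fin.natAdd (k + 1) j')) + z (Sum.inr (Fin.natAdd (k + 1) j))))) +
      bz (negTwo (aux.getD j.val (0, 0)).1) * z (Sum.inr (Fin.natAdd (k + 1) j)) := by
  rw [SymbData.monskyEvenS_mulVec_inr, sum_univ_base_aux aux]
  simp only [RealisesK.dataK_cls_natAdd]

end EvenRowsGeneral

section EvenDesignRows

open Matrix

variable {k : ℕ} (base : SymbData (k + 1)) (c₁ : AuxCell) (rest : List AuxCell)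

/-- `bz (a && b) = bz a * bz b`. -/
private theorem bz_and_eq_mul (a b : Bool) : bz (a && b) = bz a * bz b := by
  cases a <;> cases b <;> decide

/-- `bz x * bz x = bz x`. -/
private theorem bz_mul_self' (x : Bool) : bz x * bz x = bz x := by cases x <;> decide

/-- The base part of the transposition correction of a base row: `Σ_{b' ≠ b} m_b m_b' u_b' = m_b (⟨m,u⟩ + u_b)`. -/
theorem sum_corr_base_base (b : Fin (k + 1)) (u : Fin (k + 1) → ZMod 2) :
    (∑ b' : Fin (k + 1), (if b' = b then 0 else bz (negNegOne (base.cls b) && negNegOne (base.cls b')) * u b')) =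
      bz (negNegOne (base.cls b)) * (∑ b', bz (negNegOne (base.cls b')) * u b') + bz (negNegOne (base.cls b)) * u b := by
  classical
  have h : ∀ b' : Fin (k + 1), (if b' = b then 0 else bz (negNegOne (base.cls b) && negNegOne (base.cls b')) * u b') =
      bz (negNegOne (base.cls b)) * (bz (negNegOne (base.cls b')) * u b') +
        (if b' = b then bz (negNegOne (base.cls b)) * u b else 0) := by
    intro b'
    by_cases hb : b' = b
    · subst hb
      rw [if_pos rfl, if_pos rfl, ← mul_assoc, bz_mul_self']
      exact (zmod_two_add_self _).symm
    · rw [if_neg hb, if_neg hb, bz_and_eq_mul, add_zero, mul_assoc]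
  rw [Finset.sum_congr rfl fun b' _ => h b', Finset.sum_add_distrib, ← Finset.mul_sum, Finset.sum_ite_eq' Finset.univ b,
    if_pos (Finset.mem_univ b)]

/-- The auxiliary part of the transposition correction of a base row of the design: only `q₁` is `≡ 3 (4)`, so it is `m_b · u(q₁)`. -/
theorem sum_corr_base_aux (hm1 : negNegOne c₁.1 = true) (hmr : ∀ i : Fin rest.length, negNegOne (rest.getD i.val (0, 0)).1 = false)
    (b : Fin (k + 1)) (g : Fin (c₁ :: rest).length → ZMod 2) :
    (∑ j : Fin (c₁ :: rest).length, bz (negNegOne (base.cls b) && negNegOne ((c₁ :: rest).getD j.val (0, 0)).1) * g j) =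
      bz (negNegOne (base.cls b)) * g ⟨0, by simp⟩ := by
  rw [sum_fin_cons]
  have h0 : ((c₁ :: rest).getD ((⟨0, by simp⟩ : Fin (c₁ :: rest).length) : ℕ) (0, 0)) = c₁ := rfl
  have hS : ∀ i : Fin rest.length, ((c₁ :: rest).getD ((⟨i.val + 1, by simp⟩ : Fin (c₁ :: rest).length) : ℕ) (0, 0)) =
      rest.getD i.val (0, 0) := fun i => rfl
  simp only [h0, hS, hm1, hmr, Bool.and_true, Bool.and_false]
  have : (∑ i : Fin rest.length, bz false * g ⟨i.val + 1, by simp⟩) = 0 :=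
    Finset.sum_eq_zero fun i _ => by rw [show bz false = (0 : ZMod 2) from rfl, zero_mul]
  rw [this, add_zero]

/-- The transposition correction of the HEAD auxiliary row `q₁` (base part): `Σ_b m_b u_b`. -/
theorem sum_corr_head_base (hm1 : negNegOne c₁.1 = true) (u : Fin (k + 1) → ZMod 2) :
    (∑ b : Fin (k + 1), bz (negNegOne ((c₁ :: rest).getD ((⟨0, by simp⟩ : Fin (c₁ :: rest).length) : ℕ) (0, 0)).1 &&
        negNegOne (base.cls b)) * u b) = ∑ b, bz (negNegOne (base.cls b)) * u b := by
  have h0 : ((c₁ :: rest).getD ((⟨0, by simp⟩ : Fin (c₁ :: rest).length) : ℕ) (0, 0)) = c₁ := rfl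
  simp only [h0, hm1, Bool.true_and]

/-- The transposition correction of the HEAD auxiliary row `q₁` (auxiliary part) vanishes (the other cells are `≡ 1 (4)`). -/
theorem sum_corr_head_aux (hmr : ∀ i : Fin rest.length, negNegOne (rest.getD i.val (0, 0)).1 = false)
    (g : Fin (c₁ :: rest).length → ZMod 2) :
    (∑ j' : Fin (c₁ :: rest).length, (if j' = (⟨0, by simp⟩ : Fin (c₁ :: rest).length) then 0 else
      bz (negNegOne ((c₁ :: rest).getD ((⟨0, by simp⟩ : Fin (c₁ :: rest).length) : ℕ) (0, 0)).1 &&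
        negNegOne ((c₁ :: rest).getD j'.val (0, 0)).1) * g j')) = 0 := by
  refine Finset.sum_eq_zero fun j' _ => ?_
  by_cases hj : j' = (⟨0, by simp⟩ : Fin (c₁ :: rest).length)
  · rw [if_pos hj]
  · rw [if_neg hj]
    rcases fin_cons_cases c₁ rest j' with h | ⟨i, hi⟩
    · exact absurd h hj
    · rw [hi]
      show bz (negNegOne ((c₁ :: rest).getD ((⟨0, by simp⟩ : Fin (c₁ :: rest).length) : ℕ) (0, 0)).1 &&
        negNegOne (rest.getD i.val (0, 0)).1) * g ⟨i.val + 1, by simp⟩ = 0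
      rw [hmr i, Bool.and_false, show bz false = (0 : ZMod 2) from rfl, zero_mul]

/-- The transposition corrections of a TAIL auxiliary row `q_{i+1}` (`≡ 1 (4)`) vanish. -/
theorem sum_corr_tail (hmr : ∀ i : Fin rest.length, negNegOne (rest.getD i.val (0, 0)).1 = false) (i : Fin rest.length)
    (u : Fin (k + 1) → ZMod 2) (g : Fin (c₁ :: rest).length → ZMod 2) :
    (∑ b : Fin (k + 1), bz (negNegOne ((c₁ :: rest).getD ((⟨i.val + 1, by simp⟩ : Fin (c₁ :: rest).length) : ℕ) (0, 0)).1 &&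
        negNegOne (base.cls b)) * u b) = 0 ∧
    (∑ j' : Fin (c₁ :: rest).length, (if j' = (⟨i.val + 1, by simp⟩ : Fin (c₁ :: rest).length) then 0 else
      bz (negNegOne ((c₁ :: rest).getD ((⟨i.val + 1, by simp⟩ : Fin (c₁ :: rest).length) : ℕ) (0, 0)).1 &&
        negNegOne ((c₁ :: rest).getD j'.val (0, 0)).1) * g j')) = 0 := by
  have hS : ((c₁ :: rest).getD ((⟨i.val + 1, by simp⟩ : Fin (c₁ :: rest).length) : ℕ) (0, 0)) = rest.getD i.val (0, 0) := rfl
  refine ⟨Finset.sum_eq_zero fun b _ => ?_, Finset.sum_eq_zero fun j' _ => ?_⟩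
  · rw [hS, hmr i, Bool.false_and, show bz false = (0 : ZMod 2) from rfl, zero_mul]
  · split_ifs
    · rfl
    · rw [hS, hmr i, Bool.false_and, show bz false = (0 : ZMod 2) from rfl, zero_mul]

/-- ★ **EVEN design identities** (memo THEOREM-A-w3g22 §6b (E1), (E2), (Σ), now kernel-checked at general `k` and `τ`). For the
reference EVEN matrix of `(base, c₁ :: rest)` and any `z` whose base rows and both auxiliary row-sums vanish: with `u_b, v_b` the base
coordinates, `U₀, V₀` those of `q₁`, `U_i, V_i` those of `q_{i+1}`, `a_i = U_i + U₀`, `e_i = V_i + V₀` (the `v`-differences),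
`c_i = Σ_b σ_i(b)`, `⟨m,u⟩ = Σ_b m_b u_b`:
(E1) `Lu + m⟨m,u⟩ + D_d u + D_m v = Σ_i a_i σ_i` (i.e. `(Lᵀ + D_d) u + D_m (u + v) = Σ a_i σ_i`);
(E2) `D_d u + Lv + D_m v + D_d v + V₀ m = Σ_i e_i σ_i`;
(E3) `Σ_i (d'_i a_i + (c_i + d'_i) e_i) = 0`; (E4) `V₀ = ⟨m, u⟩ + Σ_i (c_i + d'_i) a_i`.
[cite: HeathBrown1994SelmerCongruentII, Appendix (Monsky), typescript p. 41 L20–L36] -/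
theorem even_design_identities (hm1 : negNegOne c₁.1 = true) (hmr : ∀ i : Fin rest.length, negNegOne (rest.getD i.val (0, 0)).1 = false)
    (σ : Fin rest.length → Fin (k + 1) → ZMod 2) (hσ : ∀ i b, bz ((rest.getD i.val (0, 0)).2.testBit b.val) = σ i b)
    (hσ1 : ∀ b : Fin (k + 1), bz (c₁.2.testBit b.val) = bz (negNegOne (base.cls b)) + ∑ i, σ i b)
    (dp : Fin rest.length → ZMod 2) (hdp : ∀ i, bz (negTwo (rest.getD i.val (0, 0)).1) = dp i)
    (hd1 : bz (negTwo c₁.1) = ∑ i, dp i)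
    (z : Fin (k + 1 + (c₁ :: rest).length) ⊕ Fin (k + 1 + (c₁ :: rest).length) → ZMod 2)
    (hrow1 : ∀ b : Fin (k + 1), ((dataK base (c₁ :: rest) (fun _ _ => false)).monskyEvenS *ᵥ z) (Sum.inl (Fin.castAdd _ b)) = 0)
    (hrow2 : ∀ b : Fin (k + 1), ((dataK base (c₁ :: rest) (fun _ _ => false)).monskyEvenS *ᵥ z) (Sum.inr (Fin.castAdd _ b)) = 0)
    (hs1 : (∑ j : Fin (c₁ :: rest).length,
      ((dataK base (c₁ :: rest) (fun _ _ => false)).monskyEvenS *ᵥ z) (Sum.inl (Fin.natAdd (k + 1) j))) = 0)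
    (hs2 : (∑ j : Fin (c₁ :: rest).length,
      ((dataK base (c₁ :: rest) (fun _ _ => false)).monskyEvenS *ᵥ z) (Sum.inr (Fin.natAdd (k + 1) j))) = 0) :
    (∀ b : Fin (k + 1),
      (∑ b', bz (base.neg b b') * (z (Sum.inl (Fin.castAdd _ b')) + z (Sum.inl (Fin.castAdd _ b)))) +
      bz (negNegOne (base.cls b)) * (∑ b', bz (negNegOne (base.cls b')) * z (Sum.inl (Fin.castAdd _ b'))) +
      bz (negTwo (base.cls b)) * z (Sum.inl (Fin.castAdd _ b)) + bz (negNegOne (base.cls b)) * z (Sum.inr (Fin.castAdd _ b)) =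
      ∑ i : Fin rest.length, σ i b * (z (Sum.inl (Fin.natAdd (k + 1) (⟨i.val + 1, by simp⟩ : Fin (c₁ :: rest).length))) +
        z (Sum.inl (Fin.natAdd (k + 1) (⟨0, by simp⟩ : Fin (c₁ :: rest).length))))) ∧
    (∀ b : Fin (k + 1),
      bz (negTwo (base.cls b)) * z (Sum.inl (Fin.castAdd _ b)) +
      (∑ b', bz (base.neg b b') * (z (Sum.inr (Fin.castAdd _ b')) + z (Sum.inr (Fin.castAdd _ b)))) +
      bz (negNegOne (base.cls b)) * z (Sum.inr (Fin.castAdd _ b)) + bz (negTwo (base.cls b)) * z (Sum.inr (Fin.castAdd _ b)) +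
      bz (negNegOne (base.cls b)) * z (Sum.inr (Fin.natAdd (k + 1) (⟨0, by simp⟩ : Fin (c₁ :: rest).length))) =
      ∑ i : Fin rest.length, σ i b * (z (Sum.inr (Fin.natAdd (k + 1) (⟨i.val + 1, by simp⟩ : Fin (c₁ :: rest).length))) +
        z (Sum.inr (Fin.natAdd (k + 1) (⟨0, by simp⟩ : Fin (c₁ :: rest).length))))) ∧
    (∑ i : Fin rest.length, (dp i * (z (Sum.inl (Fin.natAdd (k + 1) (⟨i.val + 1, by simp⟩ : Fin (c₁ :: rest).length))) +
        z (Sum.inl (Fin.natAdd (k + 1) (⟨0, by simp⟩ : Fin (c₁ :: rest).length)))) +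
      ((∑ b', σ i b') + dp i) * (z (Sum.inr (Fin.natAdd (k + 1) (⟨i.val + 1, by simp⟩ : Fin (c₁ :: rest).length))) +
        z (Sum.inr (Fin.natAdd (k + 1) (⟨0, by simp⟩ : Fin (c₁ :: rest).length)))))) = 0 ∧
    z (Sum.inr (Fin.natAdd (k + 1) (⟨0, by simp⟩ : Fin (c₁ :: rest).length))) =
      (∑ b', bz (negNegOne (base.cls b')) * z (Sum.inl (Fin.castAdd _ b'))) +
      ∑ i : Fin rest.length, ((∑ b', σ i b') + dp i) * (z (Sum.inl (Fin.natAdd (k + 1) (⟨i.val + 1, by simp⟩ : Fin (c₁ :: rest).length))) +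
        z (Sum.inl (Fin.natAdd (k + 1) (⟨0, by simp⟩ : Fin (c₁ :: rest).length)))) := by
  -- names
  set q0 : Fin (c₁ :: rest).length := ⟨0, by simp⟩ with hq0
  set U0 := z (Sum.inl (Fin.natAdd (k + 1) q0)) with hU0
  set V0 := z (Sum.inr (Fin.natAdd (k + 1) q0)) with hV0
  set U : Fin rest.length → ZMod 2 := fun i => z (Sum.inl (Fin.natAdd (k + 1) (⟨i.val + 1, by simp⟩ : Fin (c₁ :: rest).length))) with hU
  set V : Fin rest.length → ZMod 2 := fun i => z (Sum.inr (Fin.natAdd (k + 1) (⟨i.val + 1, by simp⟩ : Fin (c₁ :: rest).length))) with hV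
  set u : Fin (k + 1) → ZMod 2 := fun b => z (Sum.inl (Fin.castAdd (c₁ :: rest).length b)) with hu
  set v : Fin (k + 1) → ZMod 2 := fun b => z (Sum.inr (Fin.castAdd (c₁ :: rest).length b)) with hv
  have cls0 : ((c₁ :: rest).getD (q0 : ℕ) (0, 0)) = c₁ := rfl
  have clsS : ∀ i : Fin rest.length, ((c₁ :: rest).getD ((⟨i.val + 1, by simp⟩ : Fin (c₁ :: rest).length) : ℕ) (0, 0)) =
      rest.getD i.val (0, 0) := fun i => rfl
  have bz1 : bz true = (1 : ZMod 2) := rfl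
  have bz0 : bz false = (0 : ZMod 2) := rfl
  -- base rows
  have R1 : ∀ b : Fin (k + 1), ((∑ b', bz (base.neg b b') * (u b' + u b)) +
      (((bz (negNegOne (base.cls b)) + ∑ i, σ i b) * (U0 + u b) + ∑ i, σ i b * (U i + u b)))) +
      ((bz (negNegOne (base.cls b)) * (∑ b', bz (negNegOne (base.cls b')) * u b') + bz (negNegOne (base.cls b)) * u b) +
        bz (negNegOne (base.cls b)) * U0) +
      bz (negTwo (base.cls b)) * u b + bz (negNegOne (base.cls b)) * v b = 0 := by
    intro b
    have h := hrow1 b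
    rw [mulVecEven_inl_castAdd_expand, sum_fin_cons, sum_corr_base_base, sum_corr_base_aux base c₁ rest hm1 hmr] at h
    simp only [List.getD_cons_zero, List.getD_cons_succ, hσ1, hσ] at h
    exact h
  have R2 : ∀ b : Fin (k + 1), bz (negTwo (base.cls b)) * u b +
      ((∑ b', bz (base.neg b b') * (v b' + v b)) +
       ((bz (negNegOne (base.cls b)) + ∑ i, σ i b) * (V0 + v b) + ∑ i, σ i b * (V i + v b))) +
      bz (negTwo (base.cls b)) * v b = 0 := by
    intro b
    have h := hrow2 b
    rw [mulVecEven_inr_castAdd_expand, sum_fin_cons] at h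
    simp only [List.getD_cons_zero, List.getD_cons_succ, hσ1, hσ] at h
    exact h
  -- auxiliary row sums
  have S1 : ((∑ b, (∑ i, σ i b) * (u b + U0)) + (∑ b, bz (negNegOne (base.cls b)) * u b) + (∑ i, dp i) * U0 + V0) +
      ∑ i, ((∑ b, σ i b * (u b + U i)) + dp i * U i) = 0 := by
    have h := hs1
    rw [sum_fin_cons, mulVecEven_inl_natAdd_expand, sum_corr_head_base base c₁ rest hm1, sum_corr_head_aux c₁ rest hmr] at h
    simp only [mulVecEven_inl_natAdd_expand, sum_bz_neg_aux_aux_design base c₁ rest hmr, add_zero,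
      bz_neg_head_castAdd base c₁ rest hm1 σ hσ1, bz_neg_tail_castAdd base c₁ rest hmr σ hσ,
      List.getD_cons_zero, List.getD_cons_succ, hd1, hdp, hm1, hmr, bz1, bz0, one_mul, zero_mul,
      Bool.false_and, ite_self, Finset.sum_const_zero] at h
    exact h
  have S2 : ((∑ i, dp i) * U0 + (∑ b, (∑ i, σ i b) * (v b + V0)) + (∑ i, dp i) * V0) +
      ∑ i, (dp i * U i + (∑ b, σ i b * (v b + V i)) + dp i * V i) = 0 := by
    have h := hs2
    rw [sum_fin_cons, mulVecEven_inr_natAdd_expand] at h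
    simp only [mulVecEven_inr_natAdd_expand, sum_bz_neg_aux_aux_design base c₁ rest hmr, add_zero,
      bz_neg_head_castAdd base c₁ rest hm1 σ hσ1, bz_neg_tail_castAdd base c₁ rest hmr σ hσ,
      List.getD_cons_zero, List.getD_cons_succ, hd1, hdp] at h
    exact h
  -- normalise
  rw [sum_sum_mul_swap] at S1 S2
  simp only [mul_add, add_mul, Finset.sum_add_distrib, ← Finset.sum_mul] at R1 R2 S1 S2
  -- (E4)
  have E4 : V0 = (∑ b', bz (negNegOne (base.cls b')) * u b') + ∑ i, ((∑ b', σ i b') + dp i) * (U i + U0) := by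
    simp only [mul_add, add_mul, Finset.sum_add_distrib, ← Finset.sum_mul]
    linear_combination (norm := skip) S1
    ring_nf
    try reduce_mod_char
  -- (E3)
  have E3 : (∑ i, (dp i * (U i + U0) + ((∑ b', σ i b') + dp i) * (V i + V0))) = 0 := by
    simp only [mul_add, add_mul, Finset.sum_add_distrib, ← Finset.sum_mul]
    linear_combination (norm := skip) S2
    ring_nf
    try reduce_mod_char
  -- (E1)
  have E1 : ∀ b : Fin (k + 1), (∑ b', bz (base.neg b b') * (u b' + u b)) +
      bz (negNegOne (base.cls b)) * (∑ b', bz (negNegOne (base.cls b')) * u b') +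
      bz (negTwo (base.cls b)) * u b + bz (negNegOne (base.cls b)) * v b = ∑ i, σ i b * (U i + U0) := by
    intro b
    have R1b := R1 b
    simp only [mul_add, Finset.sum_add_distrib, ← Finset.sum_mul] at R1b ⊢
    linear_combination (norm := skip) R1b
    ring_nf
    try reduce_mod_char
  -- (E2)
  have E2 : ∀ b : Fin (k + 1), bz (negTwo (base.cls b)) * u b + (∑ b', bz (base.neg b b') * (v b' + v b)) +
      bz (negNegOne (base.cls b)) * v b + bz (negTwo (base.cls b)) * v b + bz (negNegOne (base.cls b)) * V0 =
      ∑ i, σ i b * (V i + V0) := by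
    intro b
    have R2b := R2 b
    simp only [mul_add, Finset.sum_add_distrib, ← Finset.sum_mul] at R2b ⊢
    linear_combination (norm := skip) R2b
    ring_nf
    try reduce_mod_char
  exact ⟨E1, E2, E3, E4⟩

end EvenDesignRows

end Summit.BirchSwinnertonDyer.BirchSwinnertonDyer.Theorems.SymbolicMonsky
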